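import Literature.IUT.HodgeTheaters.PMBaseThetaBridgeProofs
import HarnessLib

/-!
# [IUTchI] Prop. 6.7: the named statement `DThetaPMBridge.ThetaBridgeAlgorithm` is a SCHEMA in its predicate parameter —
# universal-closure certificate (proof-only)

S. Mochizuki, *Inter-universal Teichmüller theory I*, kurims manuscript (May 2020), §6, Proposition 6.7 p. 167 ("a functorial
algorithm for constructing a [well-defined, up to a unique isomorphism!] `𝒟-Θ`-bridge … as in Definition 4.6, (ii)")
[claim: Mochizuki2012, status: disputed] (IUTchI §6 Prop 6.7, kurims p.167).  abc-iut cell, FACT-LIST row **F-2035** of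
layer L5 (seat abc-iut-w6-d089 gen 5, row «KL5-CLOSURE-CERTS-2»).  PROOF-ONLY companion of abc-iut-L5-t4's
`PMBaseProcessions.lean` and abc-iut-w4-d054's `PMBaseThetaBridgeProofs.lean` (no `def`, no `instance`, nothing re-typed).

The typed statement `ThetaBridgeAlgorithm M P hl := ∀ B : K.DThetaPMBridge, P (B.thetaBridgeData M hl)` takes the
`𝒟-Θ`-bridge predicate of Def. 4.6 (ii) as a PARAMETER `P : K.DThetaBridgeData → Prop` (TODO-merge placeholder for
abc-iut-L5-t3's predicate).  Its bare universal closure therefore quantifies over ALL predicates and is decided at once: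
with `P := ⊥` it fails at the model `𝒟-Θ^±`-bridge of Example 6.2 (`Ex62.bridge`) over the toy base kit, with `P := ⊤`
it holds — «universal-closure REFUTED / schema; instance forms are the content».  The CONTENT of the row is
abc-iut-w4-d054's `thetaBridgeAlgorithm_of_modelConjugate` / `thetaBridgeAlgorithm_isModelConjugate`: the algorithm's
output satisfies EVERY predicate closed under Def. 4.6 (ii)'s defining conjugation condition — cited by name, untouched.

* `thetaBridgeAlgorithm_top` — holds for the trivial predicate (consistency leg);
* `not_thetaBridgeAlgorithm_bot` — fails for the empty predicate over any base kit (the model `±`-bridge exists);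
* `not_forall_thetaBridgeAlgorithm` — **F-2035 is a schema**: the universal closure is FALSE (toy base kit, any odd prime);
* `thetaBridgeAlgorithm_schema` — both legs over one and the same kit.

HONEST FRAMING: this decides a statement about OUR parametrised typing, not about print's Prop. 6.7 (whose predicate is
the specific one of Def. 4.6 (ii), for which the tree's theorem is `thetaBridgeAlgorithm_isModelConjugate`).  Nothing here
bears on [IUTchIII] Cor. 3.12 or takes a side; typed ≠ proved; refuted-as-typed ≠ refuted-in-print.
-/

namespace Literature.IUT.HodgeTheaters

namespace PMBaseKit

namespace DThetaPMBridge

universe u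

variable {l : ℕ} {K : PMBaseKit.{u} l}

/-- Prop. 6.7 as typed holds for the trivial `𝒟-Θ`-bridge predicate (consistency leg of the schema).
[claim: Mochizuki2012, status: disputed] (IUTchI §6 Prop 6.7, kurims p.167) -/
theorem thetaBridgeAlgorithm_top (M : K.MultKit) (hl : Odd l) : ThetaBridgeAlgorithm M (fun _ => True) hl :=
  fun _ => trivial

/-- Prop. 6.7 as typed FAILS for the empty `𝒟-Θ`-bridge predicate over every base kit: the model `𝒟-Θ^±`-bridge of
Example 6.2 is a `𝒟-Θ^±`-bridge to feed the algorithm. [claim: Mochizuki2012, status: disputed] (IUTchI §6 Prop 6.7, kurims p.167) -/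
theorem not_thetaBridgeAlgorithm_bot [NeZero l] (M : K.MultKit) (hl : Odd l) :
    ¬ ThetaBridgeAlgorithm M (fun _ => False) hl :=
  fun h => h (Ex62.bridge K)

/-- **F-2035 is a schema**: the universal closure of `DThetaPMBridge.ThetaBridgeAlgorithm` — over all base kits,
§4-input kits, predicates and parity proofs — is FALSE, already at the toy base kit of any odd prime `l` with the empty
predicate; the content is `thetaBridgeAlgorithm_of_modelConjugate` (abc-iut-w4-d054).
[claim: Mochizuki2012, status: disputed] (IUTchI §6 Prop 6.7, kurims p.167) -/
theorem not_forall_thetaBridgeAlgorithm (l : ℕ) [Fact l.Prime] (hl2 : l ≠ 2) :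
    ¬ ∀ (K : PMBaseKit.{0} l) (M : K.MultKit) (P : K.DThetaBridgeData → Prop) (hl : Odd l),
      ThetaBridgeAlgorithm M P hl :=
  fun h => not_thetaBridgeAlgorithm_bot (MultKit.toy l hl2) ((Fact.out : l.Prime).odd_of_ne_two hl2)
    (h (toyKit l hl2) (MultKit.toy l hl2) (fun _ => False) _)

/-- The row is a SCHEMA: over one and the same kit the statement holds for one predicate and fails for another.
[claim: Mochizuki2012, status: disputed] (IUTchI §6 Prop 6.7, kurims p.167) -/
theorem thetaBridgeAlgorithm_schema [NeZero l] (M : K.MultKit) (hl : Odd l) :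
    (∃ P : K.DThetaBridgeData → Prop, ThetaBridgeAlgorithm M P hl) ∧
      ∃ P : K.DThetaBridgeData → Prop, ¬ ThetaBridgeAlgorithm M P hl :=
  ⟨⟨_, thetaBridgeAlgorithm_top M hl⟩, ⟨_, not_thetaBridgeAlgorithm_bot M hl⟩⟩

end DThetaPMBridge

end PMBaseKit

end Literature.IUT.HodgeTheaters
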